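import Summits.QuantumFields.YangMills.Theorems.UnitScaleTiltProp7ConeRegaugeRows
import Summits.QuantumFields.YangMills.Theorems.UnitScaleTiltProp7MemberBallFramesBased
import Summits.QuantumFields.YangMills.Theorems.UnitScaleTiltProp7ExactCorrectorGaugeSockets
import HarnessLib

/-!
# Route `UnitScaleTilt`, crux K1 «MinimiserStabilityRegPr» (stmt-QuantumFields-19200), route-R E′ path (α′), (E1-b) covariant, (N-cov) near field — «CONE ROWS», FILE C:
# THE CONE FRAME AT THE MEMBER OF RECORD — for `W ∈ RegPr` (`M·α₀ ≤ a₅`), every pole `x₀` and radius `r` with `2r + 4 ≤ bigSide`, ONE frame `Fr′`, bi-contractive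
# everywhere, `Fr′ x₀ = 1`, whose framed links are `1` AT THE POLE and grow LINEARLY from it: `‖(Fr′ x)⁻¹W(x,μ)Fr′(x+e_μ) − 1‖ ≤ (τ₂ + 2τ₁²)·tdist(x, x₀)` and
# `‖h′_μ(x + e_ν) − h′_μ(x)‖ ≤ τ₂ + 4τ₁² + 2τ₁τ₂·(tdist(x,x₀) + 1)` on the ball `tdist(x, x₀) ≤ r` (`τ₁ = ηC′e^{ηC′} ≍ α₀∕ℓ_k`, `τ₂ = η(ηC′)e^{ηC′} ≍ α₀∕ℓ_k²`)

Cell `ym3-torus`, extra width seat `ym-routeR-w4` (g10); ★routeR-w3 g6 NAMER WORD (11) 2026-08-28(((ℓ + 1 : ℕ) : ℝ) ^ (K - n))⁻¹ * ((((ℓ + 1 : ℕ) : ℝ) ^ (K - n))⁻¹ * (c35 * (((ℓ + 1 : ℕ) : ℝ) * (((ℓ + 1) ^ a' : ℕ) : ℝ)) * α₀))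
                      * Real.exp ((((ℓ + 1 : ℕ) : ℝ) ^ (K - n))⁻¹ * (c35 * (((ℓ + 1 : ℕ) : ℝ) * (((ℓ + 1) ^ a' : ℕ) : ℝ)) * α₀))2:14Z «routeR-w4 g10: CONE ROWS — GO» on ym-routeR-w6 g6's spec
(22:12:41Z, LOCATE-PCOV2 §5): the constant tilt of px4 g3's ball frame ✓ `Prop7MemberBallFrames.exists_ballFrame_of_regPr` (p672574) is removed by the ordered-power
regauge at the pole (FILE A ✓ `Prop7ConeRegaugeAlgebra`, FILE B ✓ `Prop7ConeRegaugeRows`), after re-basing (✓ `Prop7MemberBallFramesBased`, p673319) so that the frame is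
trivial at the pole and the transplant's source datum at `b₋ = x₀` is untouched.  With `τ₁ ≍ e∕ℓ`, `τ₂ = a ≍ e∕ℓ²`, `r ≍ ℓ`: size slope `a(1 + 2e)`, difference `a(1 + O(e))`
— every near-field junk density becomes `≤ C·a·(1 ∨ tdist)⁻²`, no `log ℓ` (routeR-w6 g6's «WHY p = 2 ONLY»).  THEOREMS ONLY (0 `def`, 0 `sorry`);
`--supports stmt-QuantumFields-19200`, count-neutral.  YM₃ on T³ is a ladder rung (R3), not the Clay problem; nothing here claims a stub, the crux, d = 4 or the mass gap.

WHAT IS PROVED (ns `…Theorems.Prop7ConeRegauge`).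
* §1 `framedLink_regauge_eq` (`(Fr·P⁻¹)(x)⁻¹·U·(Fr·P′⁻¹)(x+e_μ) = P·((Fr x)⁻¹·U·Fr(x+e_μ))·P′⁻¹`, any group).
* §2 ★★★ `exists_coneFrame_of_regPr` — the statement in the title: `∃ c35 a₅ > 0, ∀ member, ∀ α₀ > 0, M·α₀ ≤ a₅ → ∀ W, RegPr → ∀ x₀ r, 2r + 4 ≤ bigSide → ∃ Fr′,
  (∀ z, bi-contractive) ∧ Fr′ x₀ = 1 ∧ (cone size row) ∧ (difference row)`.
HONEST SCOPE.  Bookkeeping over ✓p672574∕✓p673319 (frames), FILE A∕B (regauge algebra and torus rows); the analytic input is [B8] Prop. 6 via ✓ `reg335_reg336_T3_of_regPr`.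

References: T. Bałaban, CMP 99 (1985) 75–102 [Balaban1985RegularSpaces] ((1.33) p.82, Prop. 6 p.99); CMP 99 (1985) 389–434 [Balaban1985BackgroundPropagators] ((3.28) p.395,
(3.35) p.396); CMP 102 (1985) 255–275 [Balaban1985UV3] ((27) p.263); CMP 102 (1985) 277–309 [Balaban1985Variational] (Sect. A p.280).
-/

set_option autoImplicit false

noncomputable section

open scoped Matrix.Norms.L2Operator

namespace Summit.QuantumFields.YangMills.Theorems.Prop7ConeRegauge

open Literature.MathematicalPhysics.QuantumFieldTheory.Balaban1983to89
open Literature.MathematicalPhysics.QuantumFieldTheory.Balaban1983to89.T3ContinuumYM3Torus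
open Literature.MathematicalPhysics.QuantumFieldTheory.Balaban1983to89.T3PrintedRegularMinimiser (RegPr)
open Literature.MathematicalPhysics.QuantumFieldTheory.Balaban1983to89.B6GlobalChartV1 (PV)
open B9TorusCalculus (torusT torusT_apply)
open B6MultiLevelBoxOperator (bigSide)
open B10Eq27TorusAxialLog (unitsField toUField rel rel_self)
open B9Thm310CommutatorDataOfPlaquettes (bicontr_mul bicontr_inv)
open Summit.QuantumFields.YangMills.Theorems.Prop7SectET3Members (hd3)
open Summit.QuantumFields.YangMills.Theorems.Prop7SectET3ClassTransfer (two_mul_side_add_two_le)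
open Summit.QuantumFields.YangMills.Theorems.Prop7ConeRegaugeAlgebra (prod_ofFn_zpow_zero bicontr_prod_ofFn_zpow)
open Summit.QuantumFields.YangMills.Theorems.Prop7ConeRegaugeRows (cone_size_row cone_diff_row)
open Summit.QuantumFields.YangMills.Theorems.Prop7MemberBallFramesBased (exists_ballFrame_of_regPr_based)
open Summit.QuantumFields.YangMills.Theorems.Prop7ExactCorrectorGaugeSockets (unitsField_toUField_norm_le_one)

/-! ## §1 Letters -/

section Letters

/-- Regauging a frame by `P⁻¹` on the right conjugates the framed link: `(Fr x·P⁻¹)⁻¹·U·(Fr y·P′⁻¹) = P·((Fr x)⁻¹·U·Fr y)·P′⁻¹`. [folklore] -/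
theorem framedLink_regauge_eq {G : Type*} [Group G] (Fx Fy Pw Pw' U : G) :
    (Fx * Pw⁻¹)⁻¹ * U * (Fy * Pw'⁻¹) = Pw * (Fx⁻¹ * U * Fy) * Pw'⁻¹ := by
  group

end Letters

/-! ## §2 ★★★ The cone frame at the member -/

section Member

variable {ℓ : ℕ} {hL : Odd (ℓ + 1) ∧ 1 < ℓ + 1}

/-- ★★★ **THE CONE FRAME ON A `tdist`-BALL AT THE MEMBER OF RECORD** (see the module docstring): for `W ∈ RegPr` (`M·α₀ ≤ a₅`), every pole `x₀` and every `r` with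
`2r + 4 ≤ bigSide`, a frame `Fr′`, bi-contractive everywhere, `Fr′ x₀ = 1`, whose framed links satisfy the CONE SIZE row `≤ (τ₂ + 2τ₁²)·tdist(x, x₀)` and the DIFFERENCE row
`≤ τ₂ + 4τ₁² + 2τ₁τ₂·(tdist(x, x₀) + 1)` at every `x` with `tdist(x, x₀) ≤ r`, `τ₁ = ηC′e^{ηC′}`, `τ₂ = η(ηC′)e^{ηC′}`, `η = (L^{K−n})⁻¹`, `C′ = c35·(L·L^{a′})·α₀`.
[cite: Balaban1985RegularSpaces, (1.33) p.82, Prop. 6 p.99; Balaban1985BackgroundPropagators, (3.35) p.396, (3.28) p.395; Balaban1985UV3, (27) p.263] -/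
theorem exists_coneFrame_of_regPr (hℓ4 : 4 ≤ ℓ) :
    ∃ c35 a₅ : ℝ, 0 < c35 ∧ 0 < a₅ ∧
      ∀ (hℓ : 4 ≤ ℓ) (m : ℕ) (hm : 1 ≤ m) (n K a' R : ℕ) (hk1 : 1 ≤ K - n) (hsize : a' + 3 ≤ m + n) (hM8 : 8 ≤ (ℓ + 1) ^ a')
        (hR2 : 2 * (ℓ + 1) ^ 2 ≤ R) (α₀ : ℝ), 0 < α₀ → ((ℓ + 1 : ℕ) : ℝ) * (((ℓ + 1) ^ a' : ℕ) : ℝ) * α₀ ≤ a₅ →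
        ∀ W : GaugeField (PV 2 ℓ m K hd3 hL) 0 (Matrix.specialUnitaryGroup (Fin 2) ℂ),
          RegPr (⟨ℓ + 1, hL, m, hm⟩ : T3Family) n K α₀ W →
          ∀ (x₀ : Site (PV 2 ℓ m K hd3 hL) 0) (r : ℕ), 2 * r + 4 ≤ bigSide ℓ ((ℓ + 1) ^ a') (K - n) →
            ∃ Fr : Site (PV 2 ℓ m K hd3 hL) 0 → (Matrix (Fin 2) (Fin 2) ℂ)ˣ,
              (∀ z : Site (PV 2 ℓ m K hd3 hL) 0, ‖(Fr z : Matrix (Fin 2) (Fin 2) ℂ)‖ ≤ 1 ∧ ‖(((Fr z)⁻¹ : (Matrix (Fin 2) (Fin 2) ℂ)ˣ) : Matrix (Fin 2) (Fin 2) ℂ)‖ ≤ 1) ∧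
              Fr x₀ = 1 ∧
              (∀ (μ : Fin (PV 2 ℓ m K hd3 hL).d) (x : Site (PV 2 ℓ m K hd3 hL) 0), Site.tdist x x₀ ≤ r →
                ‖(((Fr x)⁻¹ * unitsField (toUField W) ⟨x, μ⟩ * Fr (torusT (PV 2 ℓ m K hd3 hL) 0 μ x) : (Matrix (Fin 2) (Fin 2) ℂ)ˣ) : Matrix (Fin 2) (Fin 2) ℂ) - 1‖
                  ≤ ((((ℓ + 1 : ℕ) : ℝ) ^ (K - n))⁻¹ * ((((ℓ + 1 : ℕ) : ℝ) ^ (K - n))⁻¹ * (c35 * (((ℓ + 1 : ℕ) : ℝ) * (((ℓ + 1) ^ a' : ℕ) : ℝ)) * α₀))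
                      * Real.exp ((((ℓ + 1 : ℕ) : ℝ) ^ (K - n))⁻¹ * (c35 * (((ℓ + 1 : ℕ) : ℝ) * (((ℓ + 1) ^ a' : ℕ) : ℝ)) * α₀)) + 2 * ((((ℓ + 1 : ℕ) : ℝ) ^ (K - n))⁻¹ * (c35 * (((ℓ + 1 : ℕ) : ℝ) * (((ℓ + 1) ^ a' : ℕ) : ℝ)) * α₀)
                      * Real.exp ((((ℓ + 1 : ℕ) : ℝ) ^ (K - n))⁻¹ * (c35 * (((ℓ + 1 : ℕ) : ℝ) * (((ℓ + 1) ^ a' : ℕ) : ℝ)) * α₀))) ^ 2) * (Site.tdist x x₀ : ℝ)) ∧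
              (∀ (μ ν : Fin (PV 2 ℓ m K hd3 hL).d) (x : Site (PV 2 ℓ m K hd3 hL) 0), Site.tdist x x₀ ≤ r →
                ‖(((Fr (torusT (PV 2 ℓ m K hd3 hL) 0 ν x))⁻¹ * unitsField (toUField W) ⟨torusT (PV 2 ℓ m K hd3 hL) 0 ν x, μ⟩
                      * Fr (torusT (PV 2 ℓ m K hd3 hL) 0 μ (torusT (PV 2 ℓ m K hd3 hL) 0 ν x)) : (Matrix (Fin 2) (Fin 2) ℂ)ˣ) : Matrix (Fin 2) (Fin 2) ℂ)
                    - (((Fr x)⁻¹ * unitsField (toUField W) ⟨x, μ⟩ * Fr (torusT (PV 2 ℓ m K hd3 hL) 0 μ x) : (Matrix (Fin 2) (Fin 2) ℂ)ˣ) : Matrix (Fin 2) (Fin 2) ℂ)‖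
                  ≤ (((ℓ + 1 : ℕ) : ℝ) ^ (K - n))⁻¹ * ((((ℓ + 1 : ℕ) : ℝ) ^ (K - n))⁻¹ * (c35 * (((ℓ + 1 : ℕ) : ℝ) * (((ℓ + 1) ^ a' : ℕ) : ℝ)) * α₀))
                      * Real.exp ((((ℓ + 1 : ℕ) : ℝ) ^ (K - n))⁻¹ * (c35 * (((ℓ + 1 : ℕ) : ℝ) * (((ℓ + 1) ^ a' : ℕ) : ℝ)) * α₀)) + 4 * ((((ℓ + 1 : ℕ) : ℝ) ^ (K - n))⁻¹ * (c35 * (((ℓ + 1 : ℕ) : ℝ) * (((ℓ + 1) ^ a' : ℕ) : ℝ)) * α₀)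
                      * Real.exp ((((ℓ + 1 : ℕ) : ℝ) ^ (K - n))⁻¹ * (c35 * (((ℓ + 1 : ℕ) : ℝ) * (((ℓ + 1) ^ a' : ℕ) : ℝ)) * α₀))) ^ 2 + 2 * ((((ℓ + 1 : ℕ) : ℝ) ^ (K - n))⁻¹ * (c35 * (((ℓ + 1 : ℕ) : ℝ) * (((ℓ + 1) ^ a' : ℕ) : ℝ)) * α₀)
                      * Real.exp ((((ℓ + 1 : ℕ) : ℝ) ^ (K - n))⁻¹ * (c35 * (((ℓ + 1 : ℕ) : ℝ) * (((ℓ + 1) ^ a' : ℕ) : ℝ)) * α₀))) * ((((ℓ + 1 : ℕ) : ℝ) ^ (K - n))⁻¹ * ((((ℓ + 1 : ℕ) : ℝ) ^ (K - n))⁻¹ * (c35 * (((ℓ + 1 : ℕ) : ℝ) * (((ℓ + 1) ^ a' : ℕ) : ℝ)) * α₀))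
                      * Real.exp ((((ℓ + 1 : ℕ) : ℝ) ^ (K - n))⁻¹ * (c35 * (((ℓ + 1 : ℕ) : ℝ) * (((ℓ + 1) ^ a' : ℕ) : ℝ)) * α₀))) * ((Site.tdist x x₀ : ℝ) + 1)) := by
  classical
  obtain ⟨c35, a₅, hc35, ha₅, H⟩ := exists_ballFrame_of_regPr_based (hL := hL) hℓ4
  refine ⟨c35, a₅, hc35, ha₅, ?_⟩
  intro hℓ m hm n K a' R hk1 hsize hM8 hR2 α₀ hα₀ hMα W hreg x₀ r hr
  obtain ⟨Fr, hFr, hFr1, hsize', hdiff⟩ := H hℓ m hm n K a' R hk1 hsize hM8 hR2 α₀ hα₀ hMα W hreg x₀ r hr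
  -- the framed links of px4's (re-based) ball frame
  set h : Fin (PV 2 ℓ m K hd3 hL).d → Site (PV 2 ℓ m K hd3 hL) 0 → (Matrix (Fin 2) (Fin 2) ℂ)ˣ :=
    fun μ x => (Fr x)⁻¹ * unitsField (toUField W) ⟨x, μ⟩ * Fr (torusT (PV 2 ℓ m K hd3 hL) 0 μ x) with hh
  have hb : ∀ μ x, ‖(h μ x : Matrix (Fin 2) (Fin 2) ℂ)‖ ≤ 1 ∧ ‖(((h μ x)⁻¹ : (Matrix (Fin 2) (Fin 2) ℂ)ˣ) : Matrix (Fin 2) (Fin 2) ℂ)‖ ≤ 1 :=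
    fun μ x => bicontr_mul (bicontr_mul (bicontr_inv (hFr x)) (unitsField_toUField_norm_le_one W ⟨x, μ⟩)) (hFr _)
  have h1 : ∀ (μ : Fin (PV 2 ℓ m K hd3 hL).d) (x : Site (PV 2 ℓ m K hd3 hL) 0), Site.tdist x x₀ ≤ r → ‖(h μ x : Matrix (Fin 2) (Fin 2) ℂ) - 1‖ ≤ (((ℓ + 1 : ℕ) : ℝ) ^ (K - n))⁻¹ * (c35 * (((ℓ + 1 : ℕ) : ℝ) * (((ℓ + 1) ^ a' : ℕ) : ℝ)) * α₀)
                      * Real.exp ((((ℓ + 1 : ℕ) : ℝ) ^ (K - n))⁻¹ * (c35 * (((ℓ + 1 : ℕ) : ℝ) * (((ℓ + 1) ^ a' : ℕ) : ℝ)) * α₀)) :=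
    fun μ x hx => hsize' μ x hx
  have h2 : ∀ (μ ν : Fin (PV 2 ℓ m K hd3 hL).d) (x : Site (PV 2 ℓ m K hd3 hL) 0), Site.tdist x x₀ ≤ r →
      ‖(h μ (x.shift ν) : Matrix (Fin 2) (Fin 2) ℂ) - h μ x‖ ≤ (((ℓ + 1 : ℕ) : ℝ) ^ (K - n))⁻¹ * ((((ℓ + 1 : ℕ) : ℝ) ^ (K - n))⁻¹ * (c35 * (((ℓ + 1 : ℕ) : ℝ) * (((ℓ + 1) ^ a' : ℕ) : ℝ)) * α₀))
                      * Real.exp ((((ℓ + 1 : ℕ) : ℝ) ^ (K - n))⁻¹ * (c35 * (((ℓ + 1 : ℕ) : ℝ) * (((ℓ + 1) ^ a' : ℕ) : ℝ)) * α₀)) :=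
    fun μ ν x hx => hdiff μ ν x hx
  -- no wrap-around: `2r + 4 ≤ bigSide ≤ N`
  have hN : 2 * r + 4 ≤ (PV 2 ℓ m K hd3 hL).sitesPerDir 0 := by
    have h2B := two_mul_side_add_two_le (hL := hL) hℓ m n K a' hk1 hsize (n' := 2) (by norm_num)
    omega
  -- the cone frame: `Fr′ x := Fr x · P(rel x₀ x)⁻¹`, `P(w) = ∏ (h_i x₀)^{w_i}` (ordered)
  have hk : ∀ i, ‖(h i x₀ : Matrix (Fin 2) (Fin 2) ℂ)‖ ≤ 1 ∧ ‖(((h i x₀)⁻¹ : (Matrix (Fin 2) (Fin 2) ℂ)ˣ) : Matrix (Fin 2) (Fin 2) ℂ)‖ ≤ 1 := fun i => hb i x₀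
  refine ⟨fun x => Fr x * ((List.ofFn fun i => h i x₀ ^ rel x₀ x i).prod)⁻¹, fun z => bicontr_mul (hFr z) (bicontr_inv (bicontr_prod_ofFn_zpow _ hk _)), ?_, ?_, ?_⟩
  · -- `Fr′ x₀ = Fr x₀ · P(0)⁻¹ = 1`
    show Fr x₀ * ((List.ofFn fun i => h i x₀ ^ rel x₀ x₀ i).prod)⁻¹ = 1
    rw [hFr1, rel_self, prod_ofFn_zpow_zero, inv_one, one_mul]
  · intro μ x hx
    have e := framedLink_regauge_eq (Fr x) (Fr (torusT (PV 2 ℓ m K hd3 hL) 0 μ x)) ((List.ofFn fun i => h i x₀ ^ rel x₀ x i).prod)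
      ((List.ofFn fun i => h i x₀ ^ rel x₀ (torusT (PV 2 ℓ m K hd3 hL) 0 μ x) i).prod) (unitsField (toUField W) ⟨x, μ⟩)
    rw [e]
    exact cone_size_row h x₀ hb h1 h2 hN μ hx
  · intro μ ν x hx
    have e1 := framedLink_regauge_eq (Fr x) (Fr (torusT (PV 2 ℓ m K hd3 hL) 0 μ x)) ((List.ofFn fun i => h i x₀ ^ rel x₀ x i).prod)
      ((List.ofFn fun i => h i x₀ ^ rel x₀ (torusT (PV 2 ℓ m K hd3 hL) 0 μ x) i).prod) (unitsField (toUField W) ⟨x, μ⟩)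
    have e2 := framedLink_regauge_eq (Fr (torusT (PV 2 ℓ m K hd3 hL) 0 ν x)) (Fr (torusT (PV 2 ℓ m K hd3 hL) 0 μ (torusT (PV 2 ℓ m K hd3 hL) 0 ν x)))
      ((List.ofFn fun i => h i x₀ ^ rel x₀ (torusT (PV 2 ℓ m K hd3 hL) 0 ν x) i).prod)
      ((List.ofFn fun i => h i x₀ ^ rel x₀ (torusT (PV 2 ℓ m K hd3 hL) 0 μ (torusT (PV 2 ℓ m K hd3 hL) 0 ν x)) i).prod) (unitsField (toUField W) ⟨torusT (PV 2 ℓ m K hd3 hL) 0 ν x, μ⟩)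
    rw [e1, e2]
    exact cone_diff_row h x₀ hb h1 h2 hN μ ν hx

end Member

end Summit.QuantumFields.YangMills.Theorems.Prop7ConeRegauge

end
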